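import Mathlib.NumberTheory.Cyclotomic.Basic
import Mathlib.NumberTheory.NumberField.Units.Basic
import Mathlib.NumberTheory.NumberField.InfinitePlace.TotallyRealComplex
import Mathlib.RingTheory.Norm.Basic
import HarnessLib

/-!
# Assembly of 2-power Chevalley modulo torsion from the Kummer-field case and cyclotomic descent

Helper file for the crux `HalfIntegralTwistCM` (stmt-Langlands-14036) of the route
`IrreducibilityBySelfDuality`, line `two-primary-chevalley-core`, stub S1c
(`stub_twoPowChevalleyAssembly`).  It assembles two statements, taken as hypotheses and proved
elsewhere on the line,

* (S1a) Chevalley's congruence theorem with exact `n`-th powers over a totally complex number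
  field containing a primitive `n`-th root of unity: some modulus `a > 0` forces every unit
  `u ≡ 1 (mod a)` of `𝓞 F` to be an `n`-th power of a unit;
* (S1b) cyclotomic `2^b`-descent (`b ≥ 2`) over a base containing `√-1`: an element of `K'`
  which is a `2^b`-th power in `K'(ζ_{2^b})` is a `2^b`-th power in `K'`,

into 2-power Chevalley MODULO TORSION for an arbitrary number field `K`: for every `b` there is
`a > 0` with `u ≡ 1 (mod a) ⇒ u ∈ μ(K) · (𝓞_Kˣ)^{2^b}`.

Proof.  Put `N = 2^(b+2)` and `F = CyclotomicField N K`; `F` contains a primitive `N`-th root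
of unity `ζ` (`N > 2`), so it is totally complex (`IsPrimitiveRoot.nrRealPlaces_eq_zero_of_two_lt`),
and S1a gives a modulus `a` for `F` and the exponent `N`.  The same `a` works for `K`: a unit `u`
of `𝓞 K` with `a ∣ u - 1` becomes `w^N` in `𝓞 F`; with `i = ζ^(2^b)` (`i² = -1`) and
`K' = K(i) ⊆ F`, the extension `F/K'` is `{N}`-cyclotomic, so S1b descends `u = y'^N` to
`y' ∈ K'`; taking the norm `N_{K'/K}` gives `u^d = y^N` in `K` with `d = [K' : K] ∈ {1, 2}`
(`minpoly_K i ∣ X² + 1`), and `y` is a unit of `𝓞 K` (an `N`-th root of a unit).  If `d = 1`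
then `u = (y⁴)^(2^b)`; if `d = 2` then `u² = (y^(2^(b+1)))²`, so `u = ζ₂ · (y²)^(2^b)` with
`ζ₂² = 1`, `ζ₂ ∈ torsion K`.  Mathlib only; no new definitions.
-/

noncomputable section

set_option linter.dupNamespace false -- project-wide option (lakefile weak.linter.dupNamespace); `Summit.Langlands.Langlands` is the mandated namespace

open scoped NumberField IntermediateField
open NumberField NumberField.InfinitePlace Polynomial

namespace Summit.Langlands.Langlands.Theorems.HalfIntegralTwistCM

/-- A `{n}`-cyclotomic extension `F/K` is `{n}`-cyclotomic over every intermediate field `K'`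
(same primitive root; `K`-adjoin ≤ `K'`-adjoin). [folklore] -/
theorem isCyclotomicExtension_intermediateField {K F : Type*} [Field K] [Field F] [Algebra K F]
    (K' : IntermediateField K F) (n : ℕ) [NeZero n] [h : IsCyclotomicExtension {n} K F] :
    IsCyclotomicExtension {n} K' F := by
  rw [IsCyclotomicExtension.iff_singleton] at h ⊢
  refine ⟨h.1, fun x => ?_⟩
  have hle : Algebra.adjoin K {b : F | b ^ n = 1} ≤
      (Algebra.adjoin K' {b : F | b ^ n = 1}).restrictScalars K := by
    refine Algebra.adjoin_le fun b hb => ?_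
    rw [SetLike.mem_coe, Subalgebra.mem_restrictScalars]
    exact Algebra.subset_adjoin hb
  exact (Subalgebra.mem_restrictScalars K).mp (hle (h.2 x))

/-- If `i² = -1` in a finite extension `F/K` then `[K(i) : K]` is `1` or `2`
(`minpoly_K i ∣ X² + 1`). [folklore] -/
theorem finrank_adjoin_eq_one_or_two_of_sq_eq_neg_one {K F : Type*} [Field K] [Field F]
    [Algebra K F] [FiniteDimensional K F] {i : F} (hi : i ^ 2 = -1) :
    Module.finrank K K⟮i⟯ = 1 ∨ Module.finrank K K⟮i⟯ = 2 := by
  have hint : IsIntegral K i := IsIntegral.of_finite K i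
  rw [IntermediateField.adjoin.finrank hint]
  have hpos : 0 < (minpoly K i).natDegree := minpoly.natDegree_pos hint
  have hdvd : minpoly K i ∣ X ^ 2 + C 1 := minpoly.dvd K i (by simp [hi])
  have hle : (minpoly K i).natDegree ≤ 2 := by
    calc (minpoly K i).natDegree ≤ (X ^ 2 + C 1 : K[X]).natDegree :=
          natDegree_le_of_dvd hdvd (X_pow_add_C_ne_zero two_pos 1)
      _ = 2 := natDegree_X_pow_add_C
  omega

/-- In a commutative group, `u ^ d = y ^ 2^(b+2)` with `d ∈ {1, 2}` gives `u = ζ · w^(2^b)` with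
`ζ² = 1` (`d = 1`: `ζ = 1`, `w = y⁴`; `d = 2`: `w = y²`, `ζ = u · y^(-2^(b+1))`). [folklore] -/
theorem exists_sq_eq_one_mul_pow_of_pow_eq_pow {G : Type*} [CommGroup G] {u y : G} {d b : ℕ}
    (hd : d = 1 ∨ d = 2) (h : u ^ d = y ^ 2 ^ (b + 2)) :
    ∃ ζ : G, ζ ^ 2 = 1 ∧ ∃ w : G, u = ζ * w ^ 2 ^ b := by
  rcases hd with rfl | rfl
  · refine ⟨1, one_pow 2, y ^ 4, ?_⟩
    rw [pow_one] at h
    rw [one_mul, ← pow_mul, h]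
    congr 1
    ring
  · refine ⟨u * (y ^ 2 ^ (b + 1))⁻¹, ?_, y ^ 2, ?_⟩
    · rw [mul_pow, inv_pow, ← pow_mul, ← pow_succ, h, mul_inv_cancel]
    · rw [← pow_mul, ← pow_succ', inv_mul_cancel_right]

/-- A unit of `𝓞 K` which is the `n`-th power (`n > 0`) of an element `y` of `K` is the `n`-th
power of a unit of `𝓞 K`: `y` is integral as a root of `Xⁿ - v` and invertible because `yⁿ` is.
[folklore] -/
theorem exists_units_eq_pow_of_coe_eq_pow {K : Type*} [Field K] {y : K} {n : ℕ} (hn : 0 < n)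
    (v : (𝓞 K)ˣ) (h : ((v : 𝓞 K) : K) = y ^ n) : ∃ yu : (𝓞 K)ˣ, v = yu ^ n := by
  have hint : IsIntegral ℤ y := by
    refine IsIntegral.of_pow hn ?_
    rw [← h]
    exact RingOfIntegers.isIntegral_coe _
  set y' : 𝓞 K := ⟨y, hint⟩ with hy'
  have hy'n : (v : 𝓞 K) = y' ^ n := by
    apply RingOfIntegers.coe_injective
    rw [map_pow]
    exact h
  have hu : IsUnit y' := (isUnit_pow_iff hn.ne').mp (hy'n ▸ v.isUnit)
  refine ⟨hu.unit, Units.ext ?_⟩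
  rw [Units.val_pow_eq_pow_val, IsUnit.unit_spec, ← hy'n]

/-- **Descent and norm.** If `F/K` is `{2^(b+2)}`-cyclotomic and cyclotomic `2`-power descent over
bases containing `√-1` holds (S1b), then an element `u` of `K` which is a `2^(b+2)`-th power in `F`
satisfies `u^d = y^(2^(b+2))` for some `y ∈ K` and `d ∈ {1, 2}`: descend to `K' = K(i)`,
`i = ζ^(2^b)`, and take `N_{K'/K}` (`d = [K' : K]`). [folklore] -/
theorem exists_pow_eq_pow_of_descent
    (hDesc : ∀ (K : Type) [Field K] [NumberField K] (F : Type) [Field F] [NumberField F]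
      [Algebra K F] (b : ℕ), 2 ≤ b → (∃ i : K, i ^ 2 = -1) → IsCyclotomicExtension {2 ^ b} K F →
        ∀ (u : K) (z : F), algebraMap K F u = z ^ 2 ^ b → ∃ y : K, u = y ^ 2 ^ b)
    (K : Type) [Field K] [NumberField K] (F : Type) [Field F] [NumberField F] [Algebra K F]
    (b : ℕ) [IsCyclotomicExtension {2 ^ (b + 2)} K F] (u : K) (z : F)
    (huz : algebraMap K F u = z ^ 2 ^ (b + 2)) :
    ∃ d : ℕ, (d = 1 ∨ d = 2) ∧ ∃ y : K, u ^ d = y ^ 2 ^ (b + 2) := by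
  haveI : NeZero (2 ^ (b + 2)) := ⟨by positivity⟩
  obtain ⟨ζ, hζ⟩ := IsCyclotomicExtension.exists_isPrimitiveRoot K F
    (Set.mem_singleton (2 ^ (b + 2))) (NeZero.ne _)
  -- a square root of `-1` in `F`
  set i : F := ζ ^ 2 ^ b with hidef
  have hi : i ^ 2 = -1 := by
    have h2 : IsPrimitiveRoot (ζ ^ 2 ^ (b + 1)) 2 :=
      hζ.pow (by positivity) (by rw [← pow_succ])
    rw [← h2.eq_neg_one_of_two_right, hidef, ← pow_mul, ← pow_succ]
  -- the intermediate field `K' = K(i)`; `F/K'` is `{2^(b+2)}`-cyclotomic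
  haveI : IsCyclotomicExtension {2 ^ (b + 2)} K⟮i⟯ F :=
    isCyclotomicExtension_intermediateField K⟮i⟯ (2 ^ (b + 2))
  have hi' : ∃ j : K⟮i⟯, j ^ 2 = -1 :=
    ⟨⟨i, IntermediateField.mem_adjoin_simple_self K i⟩, Subtype.ext (by simpa using hi)⟩
  -- descent to `K'`
  obtain ⟨y', hy'⟩ := hDesc K⟮i⟯ F (b + 2) (by omega) hi' inferInstance
    (algebraMap K K⟮i⟯ u) z (by rw [← IsScalarTower.algebraMap_apply]; exact huz)
  -- norm down to `K`
  refine ⟨Module.finrank K K⟮i⟯, finrank_adjoin_eq_one_or_two_of_sq_eq_neg_one hi,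
    Algebra.norm K y', ?_⟩
  rw [← Algebra.norm_algebraMap, hy', map_pow]

/-- **2-power Chevalley modulo torsion, assembled** (stub S1c of the line
`two-primary-chevalley-core`): Chevalley's congruence theorem with exact powers over totally complex
Kummer fields (S1a) and cyclotomic `2`-power descent over bases containing `√-1` (S1b) imply that
for every number field `K` and every `b` there is `a > 0` such that every unit `u` of `𝓞 K` with
`a ∣ u - 1` is a root of unity times a `2^b`-th power of a unit.  Go up to
`F = CyclotomicField (2^(b+2)) K` (totally complex), read the modulus of S1a for `F` in `𝓞 K`, get
`u = w^(2^(b+2))` in `𝓞 F`, descend and take the norm (`exists_pow_eq_pow_of_descent`):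
`u^d = y^(2^(b+2))`, `d ∈ {1, 2}`, `y` a unit of `𝓞 K`; hence `u = ζ · w^(2^b)` with `ζ² = 1`.
[folklore] -/
theorem stub_twoPowChevalleyAssembly :
    (∀ (F : Type) [Field F] [NumberField F] [IsTotallyComplex F] (n : ℕ), 0 < n →
      ∀ ζ : F, IsPrimitiveRoot ζ n →
        ∃ a : ℕ, 0 < a ∧ ∀ u : (𝓞 F)ˣ, (a : 𝓞 F) ∣ (u : 𝓞 F) - 1 → ∃ w : (𝓞 F)ˣ, u = w ^ n) →
    (∀ (K : Type) [Field K] [NumberField K] (F : Type) [Field F] [NumberField F] [Algebra K F] (b : ℕ),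
      2 ≤ b → (∃ i : K, i ^ 2 = -1) → IsCyclotomicExtension {2 ^ b} K F →
        ∀ (u : K) (z : F), algebraMap K F u = z ^ 2 ^ b → ∃ y : K, u = y ^ 2 ^ b) →
    ∀ (K : Type) [Field K] [NumberField K] (b : ℕ),
      ∃ a : ℕ, 0 < a ∧ ∀ u : (𝓞 K)ˣ, (a : 𝓞 K) ∣ (u : 𝓞 K) - 1 →
        ∃ ζ ∈ NumberField.Units.torsion K, ∃ w : (𝓞 K)ˣ, u = ζ * w ^ (2 ^ b) := by
  intro hChev hDesc K _ _ b
  haveI : NeZero (2 ^ (b + 2)) := ⟨by positivity⟩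
  -- the cyclotomic field `F = K(ζ_{2^(b+2)})` is totally complex
  obtain ⟨ζ, hζ⟩ := IsCyclotomicExtension.exists_isPrimitiveRoot K (CyclotomicField (2 ^ (b + 2)) K)
    (Set.mem_singleton (2 ^ (b + 2))) (NeZero.ne _)
  haveI : IsTotallyComplex (CyclotomicField (2 ^ (b + 2)) K) := by
    rw [← nrRealPlaces_eq_zero_iff]
    refine hζ.nrRealPlaces_eq_zero_of_two_lt ?_
    calc 2 < 4 := by norm_num
      _ ≤ 2 ^ (b + 2) := by rw [pow_add]; exact Nat.le_mul_of_pos_left _ (by positivity)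
  -- Chevalley over `F`
  obtain ⟨a, ha, hF⟩ := hChev (CyclotomicField (2 ^ (b + 2)) K) (2 ^ (b + 2)) (by positivity) _ hζ
  refine ⟨a, ha, fun u hu => ?_⟩
  -- push `u` into `𝓞 F`
  obtain ⟨w, hw⟩ := hF (Units.map (algebraMap (𝓞 K) (𝓞 (CyclotomicField (2 ^ (b + 2)) K)) :
      𝓞 K →* 𝓞 (CyclotomicField (2 ^ (b + 2)) K)) u) (by
    simpa using map_dvd (algebraMap (𝓞 K) (𝓞 (CyclotomicField (2 ^ (b + 2)) K))) hu)
  have huw : algebraMap K (CyclotomicField (2 ^ (b + 2)) K) ((u : 𝓞 K) : K) =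
      ((w : 𝓞 (CyclotomicField (2 ^ (b + 2)) K)) : CyclotomicField (2 ^ (b + 2)) K) ^
        2 ^ (b + 2) := by
    have h1 := congrArg (fun x : (𝓞 (CyclotomicField (2 ^ (b + 2)) K))ˣ =>
      ((x : 𝓞 (CyclotomicField (2 ^ (b + 2)) K)) : CyclotomicField (2 ^ (b + 2)) K)) hw
    simp only [Units.coe_map, MonoidHom.coe_coe, Units.val_pow_eq_pow_val, map_pow] at h1
    rw [← h1, RingOfIntegers.coe_eq_algebraMap, RingOfIntegers.coe_eq_algebraMap,
      ← IsScalarTower.algebraMap_apply, ← IsScalarTower.algebraMap_apply]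
  -- descent and norm: `u ^ d = y ^ 2^(b+2)` in `K`
  obtain ⟨d, hd, y, hy⟩ := exists_pow_eq_pow_of_descent hDesc K (CyclotomicField (2 ^ (b + 2)) K)
    b ((u : 𝓞 K) : K) _ huw
  -- `y` is a unit of `𝓞 K`: `u ^ d = yu ^ 2^(b+2)` in `(𝓞 K)ˣ`
  obtain ⟨yu, hrel⟩ := exists_units_eq_pow_of_coe_eq_pow (n := 2 ^ (b + 2)) (y := y)
    (by positivity) (u ^ d) (by
      rw [← hy, Units.val_pow_eq_pow_val, RingOfIntegers.coe_eq_algebraMap, map_pow])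
  -- conclude in the unit group
  obtain ⟨ζ', hζ', w', hw'⟩ := exists_sq_eq_one_mul_pow_of_pow_eq_pow hd hrel
  exact ⟨ζ', (CommGroup.mem_torsion ζ').mpr (isOfFinOrder_iff_pow_eq_one.mpr ⟨2, two_pos, hζ'⟩),
    w', hw'⟩

end Summit.Langlands.Langlands.Theorems.HalfIntegralTwistCM

end
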